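import Summits.BirchSwinnertonDyer.BirchSwinnertonDyer.Theorems.ThetaPartnerAtTwoSignedKatoUpToAtTwoSemilinearTransport
import Literature.Barriers.BirchSwinnertonDyer.PAdicFunctionalEquationParity
import Literature.NumberTheory.EllipticCurves.Kobayashi2003.SignedSelmer
import Literature.NumberTheory.EllipticCurves.KatoFineSelmerDual
import Literature.NumberTheory.EllipticCurves.PAdicBSD
import HarnessLib

/-!
# Route `ThetaPartnerAtTwo` (TP2), crux K3 `SignedKatoDivisibilityUpToAtTwo` (item stmt-BirchSwinnertonDyer-20308),
# line `colemanrat` v4 — THE IWASAWA INVOLUTION `ι : T ↦ (1+T)⁻¹ − 1` OF `Λ = ℤ_p⟦T⟧`, the `γ ↦ γ⁻¹` TWIST of the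
# pinned dual data `SignedSelmerDualData` / `FineSelmerDualData`, and the (R2′) → K3 bridge in K3's own currency

Width seat `bsd-wall-tp2-p2x-w3` g3 (cell `bsd-wall`). HONEST FRAMING: THEOREMS ONLY — no definition (the involution is
delivered as `∃ ι : Λ ≃+* Λ, ∀ f, ι f = f.subst invOnePlusSubOne` and every later statement is about ANY such `ι`), no
named fact, no instance, no `sorry`; route-independent (no `Theses` import); closes no item; BSD is NOT proved by any
of this.

## Why this file (the (R2′) repair of the K3 chain, `Λ`-specific half; companion of `…SemilinearTransport`)

Lead memo `Cruxes/SignedKatoDivisibilityUpToAtTwo/G4-CONVENTION-AUDIT.md` §3(b) (second reader: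
`W3G2-READER-G4-AUDIT.md`): the print-exact repair (R2′) of the registered stub (R2) states the Coleman/Poitou–Tate
package against the CONTRAGREDIENT dual data — in the tree's spelling `SignedSelmerDualData W κ γ⁻¹ 1` /
`FineSelmerDualData κ γ⁻¹` when `γ` is the chosen topological generator (print: `(γ·x)(s) = x(γ⁻¹ s)`; tree:
`(T·x)(s) = x(conj_γ s) − x(s)`) — and bridges to K3's `γ`-convention datum `D` «by ONE new algebra item: the
Iwasawa involution `ι : Λ ≃+* Λ`, `charIdeal (M^ι) = ι (charIdeal M)`, `ℓ_𝔭(M^ι) = ℓ_{ι𝔭}(M)`» + «ONE PUB conjunct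
`ι L♭ = u · L♭`», the latter being IN TREE (`Literature.Barriers.BirchSwinnertonDyer.
subst_invOnePlusSubOne_eq_rootNumber_of_isSprungPair_two`: `L♭(T^ι) = w_E (1+T)^{c+b} L♭` at `p = 2`, `a₂ = 0`).
This file supplies that algebra item as theorems:
* §1 the involution: `exists_ringEquiv_subst_invOnePlusSubOne` (over any domain `R`; `R⟦T⟧ = IwasawaAlgebra p` for
  `R = ℤ_p`), and for ANY `ι` with `ι f = f(T^ι)`: `invol_X`, `invol_C` (constants fixed), `invol_invol`,
  `invol_symm_apply` (`ι⁻¹ = ι`), `one_add_X_mul_invol` (`(1+T)·ι(1+T) = 1`); primes: `C_mem_comap_iff` /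
  `C_mem_map_iff` (**`p ∈ ι𝔓 ↔ p ∈ 𝔓`** — with Mathlib's `RingEquiv.height_comap/height_map` the height-one primes
  `∌ p` are permuted by `ι`), `comap_comap_invol`, `map_invol_eq_comap`; functional equation: **`L(T^ι) = v L`,
  `v ∈ Λˣ` ⟹ `ι(L) = (L)`** (`map_span_singleton_eq_of_fe`) ⟹
  **`ℓ_{ι𝔓}(Λ/(L)) = ℓ_𝔓(Λ/(L))`** (`lengthAt_quotient_span_comap_eq_of_fe`); `isUnit_intCast_mul_binomialSeries`
  (the printed multiplier `±(1+T)^c` is a unit).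
* §2 **THE `γ ↦ γ⁻¹` TWIST IS THE `ι`-TWIST** (pure algebra — `(1+T)` is a unit and `conj` is an action; no
  continuity): `toDual_invol_one_add_X_smul` (in `D : SignedSelmerDualData W κ γ ε`, `ι(1+T)` acts as `x ↦ x ∘ conj_δ`
  for `γδ = 1`), **`exists_twist_signedSelmerDualData`**: `∃ D′ : SignedSelmerDualData W κ δ ε` and `e : D.X ≃+ D′.X`
  with `e (f • x) = ι f • e x` and `D′.toDual ∘ e = D.toDual`; the same for Kato's fine dual (K2's `Y`):
  `fine_toDual_invol_one_add_X_smul`, **`exists_twist_fineSelmerDualData`**.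
* §3 with `…SemilinearTransport`: `exists_twist_signedSelmerDualData_invariants` /
  `exists_twist_fineSelmerDualData_invariants` (**torsion ⟺, `char(D′.X) = ι char(D.X)`, `ℓ_{ι𝔓}(D.X) = ℓ_𝔓(D′.X)`**);
  `iwasawaToPowerSeries_invol` (`ι` commutes with `Λ ↪ ℚ_p⟦T⟧`); and **`charIdeal_divisibility_of_contragredient`:
  THE (R2′) → K3 BRIDGE IN K3's CURRENCY** — if every `δ = γ⁻¹`-datum satisfies K3's conclusion
  `∃ g h, char = (g) ∧ (gh)^ℚ = C c · L^ℚ` and `L(T^ι) = v L` (`v` a unit), then so does every `γ`-datum.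
So a print-exact (`γ⁻¹`-convention, `Λ`-linear) package giving K3's conclusion for the contragredient data gives K3 for
the tree's data by `charIdeal_divisibility_of_contragredient` + the in-tree functional equation; no ι-symmetry of
`Col♭(loc 𝐇¹)` (the audit's objection to (R2) verbatim) is needed. References: [GreenbergLNM1716, §1 (pp. 60, 67–68)];
[Kobayashi2003, Def. 1.1]; [Kato2004Asterisque, §13]; [PerrinRiou1994, §1.3 (`M^ι`)]; [MazurTateTeitelbaum1986Invent, §I.17].
-/

set_option autoImplicit false
-- the Theorems namespace of this sub repeats the summit name by design (D-0017 nested layout)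
set_option linter.dupNamespace false

noncomputable section

open scoped Classical

namespace Summit.BirchSwinnertonDyer.BirchSwinnertonDyer.Theorems

namespace SignedKatoOffTwo.IwasawaInvolution

open PowerSeries Literature.NumberTheory.EllipticCurves Literature.NumberTheory.EllipticCurves.Module
  Literature.Barriers.BirchSwinnertonDyer

universe u

/-! ## §1 The involution `ι : T ↦ (1+T)⁻¹ − 1` of `R⟦T⟧` as a ring automorphism -/

section Involution

variable {R : Type*} [CommRing R]

/-- `ι` is involutive on power series: `(f(ι))(ι) = f`. [folklore] -/
theorem subst_invOnePlusSubOne_twice [IsDomain R] (f : R⟦X⟧) :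
    subst (invOnePlusSubOne : R⟦X⟧) (subst (invOnePlusSubOne : R⟦X⟧) f) = f := by
  rw [subst_comp_subst_apply hasSubst_invOnePlusSubOne hasSubst_invOnePlusSubOne,
    invOnePlusSubOne_subst_self, X_subst]

/-- **The Iwasawa involution as a ring automorphism**: there is a ring isomorphism `ι : R⟦T⟧ ≃+* R⟦T⟧` with
`ι f = f((1+T)⁻¹ − 1)` (substitution of `invOnePlusSubOne`), for any domain `R` (e.g. `R = ℤ_p`,
`R⟦T⟧ = IwasawaAlgebra p`). Stated as an existence so that no definition is introduced; all later statements
are about ANY `ι` with this property (there is exactly one). [cite: GreenbergLNM1716, §1 (functional equation)] -/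
theorem exists_ringEquiv_subst_invOnePlusSubOne [IsDomain R] :
    ∃ ι : R⟦X⟧ ≃+* R⟦X⟧, ∀ f : R⟦X⟧, ι f = subst (invOnePlusSubOne : R⟦X⟧) f :=
  ⟨{ toFun := fun f ↦ subst (invOnePlusSubOne : R⟦X⟧) f
     invFun := fun f ↦ subst (invOnePlusSubOne : R⟦X⟧) f
     left_inv := subst_invOnePlusSubOne_twice
     right_inv := subst_invOnePlusSubOne_twice
     map_mul' := subst_mul hasSubst_invOnePlusSubOne
     map_add' := subst_add hasSubst_invOnePlusSubOne }, fun _ ↦ rfl⟩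

variable (ι : R⟦X⟧ ≃+* R⟦X⟧) (hι : ∀ f : R⟦X⟧, ι f = subst (invOnePlusSubOne : R⟦X⟧) f)
include hι

/-- `ι T = (1+T)⁻¹ − 1`. [folklore] -/
theorem invol_X : ι X = invOnePlusSubOne := by
  rw [hι, subst_X hasSubst_invOnePlusSubOne]

/-- `ι` fixes constants: `ι (C a) = C a`. [folklore] -/
theorem invol_C (a : R) : ι (C a) = C a := by
  rw [hι]
  exact subst_C a

/-- `ι` is an involution: `ι (ι f) = f`. [folklore] -/
theorem invol_invol [IsDomain R] (f : R⟦X⟧) : ι (ι f) = f := by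
  rw [hι, hι, subst_invOnePlusSubOne_twice]

/-- `ι⁻¹ = ι`. [folklore] -/
theorem invol_symm_apply [IsDomain R] (f : R⟦X⟧) : ι.symm f = ι f := by
  conv_lhs => rw [← invol_invol ι hι f]
  rw [ι.symm_apply_apply]

/-- `(1 + T) · ι(1 + T) = 1`: `ι` inverts the unit `1 + T`. [folklore] -/
theorem one_add_X_mul_invol : (1 + X) * ι (1 + X) = 1 := by
  rw [map_add, map_one, invol_X ι hι, add_comm (1 : R⟦X⟧) invOnePlusSubOne,
    one_add_X_mul_invOnePlusSubOne_add_one]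

omit hι in
/-- `ι T = ι(1 + T) − 1`. [folklore] -/
theorem invol_X_eq_sub : ι X = ι (1 + X) - 1 := by
  rw [map_add, map_one, add_sub_cancel_left]

/-- `C c ∈ ι⁻¹(𝔓) ↔ C c ∈ 𝔓`. [folklore] -/
theorem C_mem_comap_iff (c : R) (𝔓 : Ideal R⟦X⟧) : C c ∈ 𝔓.comap ι ↔ C c ∈ 𝔓 := by
  rw [Ideal.mem_comap, invol_C ι hι]

/-- `C c ∈ ι(𝔓) ↔ C c ∈ 𝔓`. [folklore] -/
theorem C_mem_map_iff [IsDomain R] (c : R) (𝔓 : Ideal R⟦X⟧) : C c ∈ 𝔓.map ι ↔ C c ∈ 𝔓 := by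
  rw [← Ideal.comap_symm, Ideal.mem_comap, invol_symm_apply ι hι, invol_C ι hι]

/-- `ι(ι(𝔓)) = 𝔓` (comap form). [folklore] -/
theorem comap_comap_invol [IsDomain R] (𝔓 : Ideal R⟦X⟧) : (𝔓.comap ι).comap ι = 𝔓 := by
  ext f
  rw [Ideal.mem_comap, Ideal.mem_comap, invol_invol ι hι]

/-- `ι(𝔓)` as `map` is `ι⁻¹(𝔓)` as `comap` (`ι = ι⁻¹`). [folklore] -/
theorem map_invol_eq_comap [IsDomain R] (𝔓 : Ideal R⟦X⟧) : 𝔓.map ι = 𝔓.comap ι := by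
  rw [← Ideal.comap_symm]
  ext f
  rw [Ideal.mem_comap, Ideal.mem_comap, invol_symm_apply ι hι]

/-- **If `L(ι T) = v · L` with `v` a unit then `ι` fixes the ideal `(L)`** — the shape of the `p`-adic functional
equation (`Literature.Barriers.BirchSwinnertonDyer.subst_invOnePlusSubOne_eq_rootNumber_of_isSprungPair_two`:
`L♭(T^ι) = w_E (1+T)^{c+b} L♭` at `p = 2`, `a₂ = 0`). [cite: GreenbergLNM1716, §1 (functional equation)] -/
theorem map_span_singleton_eq_of_fe {L v : R⟦X⟧} (hv : IsUnit v)
    (hFE : subst (invOnePlusSubOne : R⟦X⟧) L = v * L) :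
    (Ideal.span {L}).map ι = Ideal.span {L} := by
  rw [Ideal.map_span, Set.image_singleton, hι, hFE]
  exact Ideal.span_singleton_mul_left_unit hv L

/-- **`ℓ_{ι𝔓}(R⟦T⟧/(L)) = ℓ_𝔓(R⟦T⟧/(L))` under the functional equation** (semilinear transport of the cyclic
module `R⟦T⟧/(L)` along `ι`, `…SemilinearTransport.lengthAt_quotient_span_singleton_eq`, and `(ι L) = (L)`).
[folklore] -/
theorem lengthAt_quotient_span_comap_eq_of_fe [IsDomain R] {L v : R⟦X⟧} (hv : IsUnit v)
    (hFE : subst (invOnePlusSubOne : R⟦X⟧) L = v * L) (𝔓 : PrimeSpectrum R⟦X⟧) :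
    lengthAt R⟦X⟧ (R⟦X⟧ ⧸ Ideal.span {L}) ⟨𝔓.asIdeal.comap ι, inferInstance⟩ =
      lengthAt R⟦X⟧ (R⟦X⟧ ⧸ Ideal.span {L}) 𝔓 := by
  rw [SemilinearTransport.lengthAt_quotient_span_singleton_eq (σ := ι) L
    (𝔭 := ⟨𝔓.asIdeal.comap ι, inferInstance⟩) (𝔓 := 𝔓) rfl]
  have h : Ideal.span {ι L} = Ideal.span {L} := by
    rw [hι, hFE]; exact Ideal.span_singleton_mul_left_unit hv L
  exact lengthAt_eq_of_linearEquiv (Submodule.quotEquivOfEq _ _ h) 𝔓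

omit hι in
/-- The multiplier of the printed functional equation is a unit: `w · (1+T)^c` with `w = ±1`. [folklore] -/
theorem isUnit_intCast_mul_binomialSeries [BinomialRing R] {w : ℤ} (hw : w = 1 ∨ w = -1) (c : R) :
    IsUnit ((w : R⟦X⟧) * binomialSeries R c) := by
  refine IsUnit.mul ?_ ?_
  · rcases hw with rfl | rfl
    · simp
    · rw [Int.cast_neg, Int.cast_one]; exact isUnit_one.neg
  · rw [isUnit_iff_constantCoeff, binomialSeries_constantCoeff]; exact isUnit_one

end Involution

/-! ## §2 The Γ-convention twist of the pinned dual data: `γ ↦ γ⁻¹` is the `ι`-twist -/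

section Twist

variable {K : Type u} [Field K] [NumberField K] {p : ℕ} [Fact p.Prime]
  {W : WeierstrassCurve K} {κ : ZpExtension K p} {γ δ : Field.absoluteGaloisGroup K} {ε : ℤˣ}
  (ι : IwasawaAlgebra p ≃+* IwasawaAlgebra p)
  (hι : ∀ f : IwasawaAlgebra p, ι f = subst (invOnePlusSubOne : ℤ_[p]⟦X⟧) f)
include hι

open Kobayashi2003 in
/-- **KEY COMPUTATION** in a datum `D : SignedSelmerDualData W κ γ ε` (`T` acts as `x ↦ x ∘ conj_γ − x`): the unit
`ι(1+T) = (1+T)⁻¹` acts as `x ↦ x ∘ conj_δ` for `γ δ = 1` — because `1 + T` acts as `x ↦ x ∘ conj_γ` and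
`conj_γ ∘ conj_δ = conj_1 = id` (`conjH1_mul`, `conjH1_one`). Pure algebra; no continuity. [folklore] -/
theorem toDual_invol_one_add_X_smul (hγδ : γ * δ = 1) (D : SignedSelmerDualData W κ γ ε) (x : D.X)
    (s : signedSelmerInfty W κ ε) :
    D.toDual (ι (1 + X) • x) s =
      D.toDual x ⟨W.conjH1 p κ.kerSubgroup δ s, conjH1_mem_signedSelmerInfty W κ ε δ s.2⟩ := by
  set y : D.X := ι (1 + X) • x with hy
  have hx : x = (1 + X : IwasawaAlgebra p) • y := by
    rw [hy, ← mul_smul, one_add_X_mul_invol ι hι, one_smul]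
  have h1 : ∀ s' : signedSelmerInfty W κ ε, D.toDual ((1 + X : IwasawaAlgebra p) • y) s' =
      D.toDual y ⟨W.conjH1 p κ.kerSubgroup γ s', D.conj_mem _ s'.2⟩ := by
    intro s'
    rw [add_smul, one_smul, map_add, AddMonoidHom.add_apply, D.toDual_T_smul, add_sub_cancel]
  conv_rhs => rw [hx, h1]
  congr 1
  apply Subtype.ext
  change (s : W.subgroupH1 p κ.kerSubgroup) =
    W.conjH1 p κ.kerSubgroup γ (W.conjH1 p κ.kerSubgroup δ (s : W.subgroupH1 p κ.kerSubgroup))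
  rw [← AddMonoidHom.comp_apply, ← W.conjH1_mul_holds p κ.kerSubgroup γ δ, hγδ,
    W.conjH1_one_holds p κ.kerSubgroup, AddMonoidHom.id_apply]

open Kobayashi2003 in
/-- **THE TWIST `γ ↦ γ⁻¹` OF A SIGNED DUAL DATUM IS ITS `ι`-TWIST.** For `γ δ = 1` and every pinned datum
`D : SignedSelmerDualData W κ γ ε` there is a datum `D′ : SignedSelmerDualData W κ δ ε` on the SAME character
group (`D′.toDual ∘ e = D.toDual`) whose `Λ`-structure is the `ι`-twist: `e (f • x) = ι f • e x`. (Construction: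
`D′.X := D.X` with `f •′ x := ι f • x`; `T •′ x = (ι(1+T) − 1) • x = x ∘ conj_δ − x` by
`toDual_invol_one_add_X_smul`; constants are fixed by `ι`.) With `…SemilinearTransport`: `char(D′.X) = ι char(D.X)`,
`ℓ_𝔓(D′.X) = ℓ_{ι𝔓}(D.X)`, torsion ⟺ torsion. In print (Kobayashi Def. 1.1, Kato §13) the dual carries the
contragredient action, i.e. is the tree's `δ = γ⁻¹` datum when `γ` is the chosen generator.
[cite: Kobayashi2003, Def. 1.1 and Thm. 1.2 (the object only)] [cite: GreenbergLNM1716, §1 (functional equation)] -/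
theorem exists_twist_signedSelmerDualData (hγδ : γ * δ = 1) (D : SignedSelmerDualData W κ γ ε) :
    ∃ (D' : SignedSelmerDualData W κ δ ε) (e : D.X ≃+ D'.X),
      (∀ (f : IwasawaAlgebra p) (x : D.X), e (f • x) = ι f • e x) ∧
      ∀ x : D.X, D'.toDual (e x) = D.toDual x := by
  have hmem : ∀ s ∈ signedSelmerInfty W κ ε, W.conjH1 p κ.kerSubgroup δ s ∈ signedSelmerInfty W κ ε :=
    fun s hs ↦ conjH1_mem_signedSelmerInfty W κ ε δ hs
  refine ⟨@SignedSelmerDualData.mk K _ _ p _ W κ δ ε D.X D.addCommGroup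
      (Module.compHom D.X (ι : IwasawaAlgebra p →+* IwasawaAlgebra p)) hmem D.toDual D.bijective ?_ ?_,
    AddEquiv.refl D.X, ?_, ?_⟩
  · intro x s
    change D.toDual (ι X • x) s = _
    rw [invol_X_eq_sub ι, sub_smul, one_smul, map_sub, AddMonoidHom.sub_apply,
      toDual_invol_one_add_X_smul ι hι hγδ D x s]
  · intro c x s k hk
    change D.toDual (ι (C c) • x) s = _
    rw [invol_C ι hι]
    exact D.toDual_C_smul c x s k hk
  · intro f x
    change f • x = ι (ι f) • x
    rw [invol_invol ι hι]
  · intro x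
    rfl

/-- The same for Kato's FINE Selmer dual data `W.FineSelmerDualData κ γ` (K2's `Y`): the unit `ι(1+T)` acts as
`x ↦ x ∘ conj_δ`. [folklore] -/
theorem fine_toDual_invol_one_add_X_smul (hγδ : γ * δ = 1) (Y : W.FineSelmerDualData κ γ) (x : Y.X)
    (s : W.fineSelmerInfty κ) :
    Y.toDual (ι (1 + X) • x) s =
      Y.toDual x ⟨W.conjH1 p κ.kerSubgroup δ s, W.conjH1_mem_fineSelmerInfty κ δ s.2⟩ := by
  set y : Y.X := ι (1 + X) • x with hy
  have hx : x = (1 + X : IwasawaAlgebra p) • y := by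
    rw [hy, ← mul_smul, one_add_X_mul_invol ι hι, one_smul]
  have h1 : ∀ s' : W.fineSelmerInfty κ, Y.toDual ((1 + X : IwasawaAlgebra p) • y) s' =
      Y.toDual y ⟨W.conjH1 p κ.kerSubgroup γ s', W.conjH1_mem_fineSelmerInfty κ γ s'.2⟩ := by
    intro s'
    rw [add_smul, one_smul, map_add, AddMonoidHom.add_apply, Y.toDual_T_smul, add_sub_cancel]
  conv_rhs => rw [hx, h1]
  congr 1
  apply Subtype.ext
  change (s : W.subgroupH1 p κ.kerSubgroup) =
    W.conjH1 p κ.kerSubgroup γ (W.conjH1 p κ.kerSubgroup δ (s : W.subgroupH1 p κ.kerSubgroup))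
  rw [← AddMonoidHom.comp_apply, ← W.conjH1_mul_holds p κ.kerSubgroup γ δ, hγδ,
    W.conjH1_one_holds p κ.kerSubgroup, AddMonoidHom.id_apply]

/-- **THE TWIST `γ ↦ γ⁻¹` OF A FINE DUAL DATUM IS ITS `ι`-TWIST** (Kato's `X₀`; K2's `Y`).
[cite: Kato2004Asterisque, Conj. 12.10 (p. 224)] [cite: GreenbergLNM1716, §1 (functional equation)] -/
theorem exists_twist_fineSelmerDualData (hγδ : γ * δ = 1) (Y : W.FineSelmerDualData κ γ) :
    ∃ (Y' : W.FineSelmerDualData κ δ) (e : Y.X ≃+ Y'.X),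
      (∀ (f : IwasawaAlgebra p) (x : Y.X), e (f • x) = ι f • e x) ∧
      ∀ x : Y.X, Y'.toDual (e x) = Y.toDual x := by
  refine ⟨@WeierstrassCurve.FineSelmerDualData.mk K _ _ W p _ κ δ Y.X Y.addCommGroup
      (Module.compHom Y.X (ι : IwasawaAlgebra p →+* IwasawaAlgebra p)) Y.toDual Y.bijective ?_ ?_,
    AddEquiv.refl Y.X, ?_, ?_⟩
  · intro x s
    change Y.toDual (ι X • x) s = _
    rw [invol_X_eq_sub ι, sub_smul, one_smul, map_sub, AddMonoidHom.sub_apply,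
      fine_toDual_invol_one_add_X_smul ι hι hγδ Y x s]
  · intro c x s k hk
    change Y.toDual (ι (C c) • x) s = _
    rw [invol_C ι hι]
    exact Y.toDual_C_smul c x s k hk
  · intro f x
    change f • x = ι (ι f) • x
    rw [invol_invol ι hι]
  · intro x
    rfl

end Twist


/-! ## §3 Consequences for K3: invariants of the twisted datum, and the bridge in K3's own currency -/

section Bridge

variable {K : Type u} [Field K] [NumberField K] {p : ℕ} [Fact p.Prime]
  {W : WeierstrassCurve K} {κ : ZpExtension K p} {γ δ : Field.absoluteGaloisGroup K} {ε : ℤˣ}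
  (ι : IwasawaAlgebra p ≃+* IwasawaAlgebra p)
  (hι : ∀ f : IwasawaAlgebra p, ι f = subst (invOnePlusSubOne : ℤ_[p]⟦X⟧) f)
include hι

open Kobayashi2003 in
/-- **The twisted datum and its invariants, packaged**: for `γ δ = 1` and `D : SignedSelmerDualData W κ γ ε` there is
`D′ : SignedSelmerDualData W κ δ ε` on the same character group with `Λ`-structure twisted by `ι`, and
`D.X` torsion ⟺ `D′.X` torsion, `char(D′.X) = ι(char(D.X))`, `ℓ_{ι𝔓}(D.X) = ℓ_𝔓(D′.X)` for every prime `𝔓`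
(`…SemilinearTransport`). [folklore] -/
theorem exists_twist_signedSelmerDualData_invariants (hγδ : γ * δ = 1) (D : SignedSelmerDualData W κ γ ε) :
    ∃ (D' : SignedSelmerDualData W κ δ ε) (e : D.X ≃+ D'.X),
      (∀ (f : IwasawaAlgebra p) (x : D.X), e (f • x) = ι f • e x) ∧
      (∀ x : D.X, D'.toDual (e x) = D.toDual x) ∧
      (Module.IsTorsion (IwasawaAlgebra p) D.X ↔ Module.IsTorsion (IwasawaAlgebra p) D'.X) ∧
      D'.charIdeal = D.charIdeal.map ι ∧
      ∀ 𝔓 : PrimeSpectrum (IwasawaAlgebra p),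
        lengthAt (IwasawaAlgebra p) D.X ⟨𝔓.asIdeal.comap ι, inferInstance⟩ =
          lengthAt (IwasawaAlgebra p) D'.X 𝔓 := by
  obtain ⟨D', e, he, hdual⟩ := exists_twist_signedSelmerDualData ι hι hγδ D
  exact ⟨D', e, he, hdual, SemilinearTransport.isTorsion_iff_of_semilinear ι e he,
    SemilinearTransport.charIdeal_eq_map ι e he,
    fun 𝔓 ↦ SemilinearTransport.lengthAt_eq ι e he rfl⟩

/-- The fine analogue of `exists_twist_signedSelmerDualData_invariants` (Kato's `X₀`, K2's `Y`). [folklore] -/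
theorem exists_twist_fineSelmerDualData_invariants (hγδ : γ * δ = 1) (Y : W.FineSelmerDualData κ γ) :
    ∃ (Y' : W.FineSelmerDualData κ δ) (e : Y.X ≃+ Y'.X),
      (∀ (f : IwasawaAlgebra p) (x : Y.X), e (f • x) = ι f • e x) ∧
      (∀ x : Y.X, Y'.toDual (e x) = Y.toDual x) ∧
      (Module.IsTorsion (IwasawaAlgebra p) Y.X ↔ Module.IsTorsion (IwasawaAlgebra p) Y'.X) ∧
      Y'.charIdeal = Y.charIdeal.map ι ∧
      ∀ 𝔓 : PrimeSpectrum (IwasawaAlgebra p),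
        lengthAt (IwasawaAlgebra p) Y.X ⟨𝔓.asIdeal.comap ι, inferInstance⟩ =
          lengthAt (IwasawaAlgebra p) Y'.X 𝔓 := by
  obtain ⟨Y', e, he, hdual⟩ := exists_twist_fineSelmerDualData ι hι hγδ Y
  exact ⟨Y', e, he, hdual, SemilinearTransport.isTorsion_iff_of_semilinear ι e he,
    SemilinearTransport.charIdeal_eq_map ι e he,
    fun 𝔓 ↦ SemilinearTransport.lengthAt_eq ι e he rfl⟩

omit hι in
/-- `T^ι` has integer coefficients: the coefficient embedding `Λ ↪ ℚ_p⟦T⟧` maps `invOnePlusSubOne` to itself.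
[folklore] -/
theorem map_invOnePlusSubOne_padic :
    MvPowerSeries.map (algebraMap ℤ_[p] ℚ_[p]) (invOnePlusSubOne : ℤ_[p]⟦X⟧) =
      (invOnePlusSubOne : ℚ_[p]⟦X⟧) := by
  change PowerSeries.map (algebraMap ℤ_[p] ℚ_[p]) (invOnePlusSubOne : ℤ_[p]⟦X⟧) = _
  ext n
  simp only [coeff_map, coeff_invOnePlusSubOne]
  split_ifs <;> simp

/-- `ι` commutes with the coefficient embedding `Λ ↪ ℚ_p⟦T⟧`: `(ι f)^ℚ = (f^ℚ)(T^ι)`. [folklore] -/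
theorem iwasawaToPowerSeries_invol (f : IwasawaAlgebra p) :
    iwasawaToPowerSeries p (ι f) =
      subst (invOnePlusSubOne : ℚ_[p]⟦X⟧) (iwasawaToPowerSeries p f) := by
  have hm := map_subst (hasSubst_invOnePlusSubOne (R := ℤ_[p])) (h := algebraMap ℤ_[p] ℚ_[p]) f
  rw [map_invOnePlusSubOne_padic] at hm
  rw [hι]
  exact hm

/-- **THE (R2′) → K3 BRIDGE IN K3's OWN CURRENCY.** Suppose the print-exact divisibility is known for every datum in
the CONTRAGREDIENT (`δ = γ⁻¹`) convention, in the shape of K3's conclusion: `∃ g h, char(D′.X) = (g) ∧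
(g h)^ℚ = C c · L^ℚ` (`L = L♭`, `c = 2^m ϖ`), and suppose the functional equation `L(T^ι) = v · L`, `v ∈ Λˣ`
(tree: `subst_invOnePlusSubOne_eq_rootNumber_of_isSprungPair_two` with `isUnit_intCast_mul_binomialSeries`). Then the
SAME conclusion holds for every datum `D` in the tree's `γ`-convention: `char(D.X) = (ι g′)`, and
`ι g′ · (ι h′ · v⁻¹)` has `ℚ_p`-image `C c · L^ℚ` (apply `ι` to `(g′h′)^ℚ = C c L^ℚ`, `ι` fixes `C c`, `ι L = v L`).
[cite: GreenbergLNM1716, §1 (functional equation)] [cite: Kobayashi2003, Def. 1.1 and Thm. 1.2 (the object only)] -/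
theorem charIdeal_divisibility_of_contragredient (hγδ : γ * δ = 1) {L v : IwasawaAlgebra p} (hv : IsUnit v)
    (hFE : subst (invOnePlusSubOne : ℤ_[p]⟦X⟧) L = v * L) (c : ℚ_[p])
    (hD' : ∀ D' : Kobayashi2003.SignedSelmerDualData W κ δ ε, ∃ g h : IwasawaAlgebra p,
      D'.charIdeal = Ideal.span {g} ∧
        iwasawaToPowerSeries p (g * h) = PowerSeries.C c * iwasawaToPowerSeries p L)
    (D : Kobayashi2003.SignedSelmerDualData W κ γ ε) :
    ∃ g h : IwasawaAlgebra p, D.charIdeal = Ideal.span {g} ∧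
      iwasawaToPowerSeries p (g * h) = PowerSeries.C c * iwasawaToPowerSeries p L := by
  obtain ⟨D', e, he, -, -, hchar, -⟩ := exists_twist_signedSelmerDualData_invariants ι hι hγδ D
  obtain ⟨g', h', hg', hgh'⟩ := hD' D'
  refine ⟨ι g', ι h' * ↑(hv.unit⁻¹), ?_, ?_⟩
  · -- `char(D.X) = ι (ι char(D.X)) = ι (char D′.X) = ι (g′) = (ι g′)`
    have h1 : D.charIdeal = (D'.charIdeal).map ι := by
      rw [hchar, map_invol_eq_comap ι hι, map_invol_eq_comap ι hι, comap_comap_invol ι hι]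
    rw [h1, hg', Ideal.map_span, Set.image_singleton]
  · -- apply `ι` (over `ℚ_p`) to `(g′h′)^ℚ = C c · L^ℚ`
    have hιL : ι L = v * L := by rw [hι, hFE]
    have key : iwasawaToPowerSeries p (ι g' * ι h') =
        PowerSeries.C c * iwasawaToPowerSeries p v * iwasawaToPowerSeries p L := by
      rw [← map_mul ι, iwasawaToPowerSeries_invol ι hι, hgh', subst_mul hasSubst_invOnePlusSubOne,
        ← iwasawaToPowerSeries_invol ι hι, hιL, map_mul, ← mul_assoc]
      congr 2
      exact subst_C c
    have hvu : v * ↑(hv.unit⁻¹) = 1 := hv.mul_val_inv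
    calc iwasawaToPowerSeries p (ι g' * (ι h' * ↑(hv.unit⁻¹)))
        = iwasawaToPowerSeries p (ι g' * ι h') * iwasawaToPowerSeries p ↑(hv.unit⁻¹) := by
          rw [← map_mul, mul_assoc]
      _ = PowerSeries.C c * iwasawaToPowerSeries p L * iwasawaToPowerSeries p (v * ↑(hv.unit⁻¹)) := by
          rw [key, map_mul]; ring
      _ = PowerSeries.C c * iwasawaToPowerSeries p L := by rw [hvu, map_one, mul_one]

end Bridge

end SignedKatoOffTwo.IwasawaInvolution

end Summit.BirchSwinnertonDyer.BirchSwinnertonDyer.Theorems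

end
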